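/-
Copyright (c) 2026. All rights reserved.
Released under Apache 2.0 license as described in the file LICENSE.
Authors: abc-iut cell, wave-6 cone prover seat abc-iut-w6-d025 (gen 4; self-row «ARC-MONOAN-CHART-FUNCTOR» after
«PROP58vii-ARC-GENUINE»), over abc-iut-L4-t2's `AutHolFieldFunctor` (Cor 2.7 (e) interface), abc-iut-w5-d210's model
construction (`TMMonoNonVacuity.lean`, adapted into a definition) and this seat's `MonoAnalyticArchGammaFunctor.lean` /
`LogFrobeniusArchGenuineMonoAn.lean`.
-/
import Literature.AnabelianGeometry.AbsoluteAnabelian.LogFrobeniusArchGenuineMonoAn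
import Mathlib.Analysis.Complex.Basic
import HarnessLib

/-!
# [AbsTopIII] Def 5.6 (ii)(c) / Def 5.9 (i): the mono-analyticization `EA → TM⊢`, `𝕏 ↦ (𝒪^▷_{𝒜_𝕏}, 𝒪^▷_{𝒜_𝕏} ∩ ℝ_{>0})`,
# as a GENUINE FUNCTOR over an Aut-holomorphic field functor, and the §5 setting with genuine `ℰ• → ℰ⊢`

S. Mochizuki, *Topics in absolute anabelian geometry III*, J. Math. Sci. Univ. Tokyo 22 (2015) [MochizukiAbsTopIII2015];
manuscript `paper:url-5493eb38cbb7`, read on the page (own render): Def 5.6 (ii)(c) p. 135 ("`G_w` is the object of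
`Orb(TM⊢)` determined by [the] pair … `(𝒪^▷_{𝒜_{X_v}}, 𝒪^▷_{𝒜_{X_v}} ∩ ℝ_{>0})`"), Def 5.6 (i) p. 134 (`TM⊢`), Rmk 5.8.1 (i)
p. 142 ("applying the operation of mono-analyticization to an isomorph of `𝒪^▷_ℂ` yields the object of `TM⊢` consisting
of an isomorph of the topological monoid `𝒪^▷_ℂ` equipped with the submonoid corresponding to `𝒪^▷_ℂ ∩ ℝ_{>0}` … The
operation of mono-analyticization consists of forgetting the rigidification of the [Aut-]holomorphic structure"), Cor 2.7
(e) p. 60 (the topological field `𝒜_𝕏`, a CAF, functorial in `𝕏`).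

## What this file builds (cell self-row «ARC-MONOAN-CHART-FUNCTOR»; removes honest limit (L1) of
`LogFrobeniusArchGenuineMonoAn.lean` for the arrow `ℰ• → ℰ⊢`)

* `TMMono.complexRay`, `TMMono.complexModel` — the tree's model object `(𝒪^▷_ℂ, ]0,1])` of `TM⊢` (abc-iut-w5-d210's
  `TMMono.nonempty_model`, whose witness is built inside a theorem) as a DEFINITION, so that its ray `]0,1]` is
  available by name (the polar-decomposition proof is adapted verbatim);
* `AutHolFieldFunctor.cafChart 𝕏` — THE bicontinuous field isomorphism `e_𝕏 : 𝒜_𝕏 ≅ ℂ` (Cor 2.7 (e): `𝒜_𝕏` is a CAF),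
  chosen once; `integralMonoid 𝕏 = 𝒪^▷_{𝒜_𝕏} := e_𝕏⁻¹(𝒪^▷_ℂ)`, `integralChart 𝕏 : 𝒪^▷_{𝒜_𝕏} ≅ 𝒪^▷_ℂ`;
* `AutHolFieldFunctor.transition_eq_id_or_conj` — for a morphism `f : 𝕏 → 𝕐` of `EA` the continuous field automorphism
  `e_𝕐 ∘ 𝒜_f ∘ e_𝕏⁻¹` of `ℂ` is the identity or complex conjugation (Mathlib `Complex.ringHom_eq_id_or_conj_of_continuous`),
  hence preserves `‖·‖`, `Re` and `|Im|`: `𝒜_f` carries `𝒪^▷_{𝒜_𝕏}` onto `𝒪^▷_{𝒜_𝕐}` and the ray `e_𝕏⁻¹(]0,1])` onto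
  `e_𝕐⁻¹(]0,1])` WITHOUT any compatibility between the chosen charts — "forgetting the rigidification": `Aut(𝕏)` acts on
  `G_𝕏` through `{id, conj} ⊆ Aut_{TM⊢}(G_𝕏)`;
* `AutHolFieldFunctor.toTMMono : 𝔄.EA ⥤ TMMono` — **the mono-analyticization functor `EA → TM⊢`**,
  `𝕏 ↦ G_𝕏 := (𝒪^▷_{𝒜_𝕏}, 𝒪^▷_{𝒜_𝕏} ∩ ℝ_{>0})` (via `TMMono.ofMulEquiv` along `integralChart`, lifted one universe for the
  §5 interface), `f ↦ 𝒜_f|_{𝒪^▷}`; functor laws from `Amap_id`, `Amap_comp`;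
* `LogFrobeniusSetting.archGenuineMonoAnChart 𝔄 Vmod isArc` — `archGenuineMonoAn 𝔄` with `ℰ• → ℰ⊢ := toTMMono` and
  `𝒩_v → 𝒩⊢_v := ((𝕏 ↶ M) ↦ (G_𝕏, k∼))` GENUINE in the `TM⊢`-component; theorems `_monoAn`, `_ψOver` (rfl),
  `_monoN_toEmono_eq` (rows 4 → 5 on the nose), `MonoAnalyticizationHomotopies`, Cor 5.10 (iv)(a), Cor 5.5 (iv) s1,
  summary `exists_archGenuineMonoAnChart`.

HONEST LIMITS (named): (L1′) the `TB⊞`-component of `𝒩_v → 𝒩⊢_v` (Def 5.6 (iv): `𝒞^hol_{TH} → 𝒞^{hol⊢}_{TB⊞}`, the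
arithmetic datum `M ∈ {k∼, k×, …}` of a holomorphic pair read as a `TB⊞`-object) stays the constant `k∼` (not constructed in
the tree); (L2)–(L4) of `LogFrobeniusArchGenuineMonoAn.lean` unchanged; one CAF chart per `𝕏` chosen inside the
definitions, functoriality PROVED (the transition automorphisms are `id` or `conj`, both morphisms of `TM⊢`).  MODEL-LEVEL
(abc-iut-L4-t2's Aut-holomorphic model over the interface `AutHolFieldFunctor`); refereed pre-IUT material; classical
complex analysis; nothing here bears on [IUTchIII] Cor. 3.12; no side taken; typed ≠ proved elsewhere.
-/

set_option autoImplicit false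

noncomputable section

open CategoryTheory Topology Complex

universe u

namespace Literature.AnabelianGeometry.AbsoluteAnabelian

/-! ## §0. The standard object `(𝒪^▷_ℂ, ]0,1])` of `TM⊢` as a definition -/

namespace TMMono
/-- The ray `𝒪^▷_ℂ ∩ ℝ_{>0} = ]0,1]` as a submonoid of `𝒪^▷_ℂ`. [cite: MochizukiAbsTopIII2015, Def 5.6 (ii) p.135] -/
def complexRay : Submonoid complexIntegralMonoid where
  carrier := {x | (x : ℂ).im = 0 ∧ 0 < (x : ℂ).re}
  mul_mem' := by
    rintro a b ⟨ha0, ha1⟩ ⟨hb0, hb1⟩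
    refine ⟨?_, ?_⟩
    · show (((a : ℂ) * (b : ℂ))).im = 0
      rw [Complex.mul_im, ha0, hb0, mul_zero, zero_mul, add_zero]
    · show 0 < (((a : ℂ) * (b : ℂ))).re
      rw [Complex.mul_re, ha0, hb0, mul_zero, sub_zero]
      exact mul_pos ha1 hb1
  one_mem' := ⟨Complex.one_im, by show 0 < ((1 : ℂ)).re; rw [Complex.one_re]; exact one_pos⟩
/-- Membership in the ray: `Im z = 0` and `Re z > 0`. [cite: MochizukiAbsTopIII2015, Def 5.6 (ii) p.135] -/
theorem mem_complexRay_iff (x : complexIntegralMonoid) : x ∈ complexRay ↔ (x : ℂ).im = 0 ∧ 0 < (x : ℂ).re := Iff.rfl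
/-- **The standard object `(𝒪^▷_ℂ, 𝒪^▷_ℂ ∩ ℝ_{>0})` of `TM⊢`** (Def 5.6 (ii)(c) for `𝒜_𝕏 = ℂ`), as a DEFINITION: the units of
`𝒪^▷_ℂ` are the unit circle and the polar decomposition `z ↦ (z/‖z‖, ‖z‖)` is a continuous two-sided inverse of
`(u, t) ↦ u·t` (abc-iut-w5-d210's proof of `TMMono.nonempty_model`, adapted). [cite: MochizukiAbsTopIII2015, Def 5.6 (i) p.134] -/
def complexModel : TMMono.{0} where
  C := complexIntegralMonoid
  pos := complexRay
  exists_iso := ⟨MulEquiv.refl _, continuous_id, continuous_id⟩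
  isHomeomorph_mul := by
    classical
    have hP_eq : ∀ t : complexRay, ((t : complexIntegralMonoid) : ℂ) = ((((t : complexIntegralMonoid) : ℂ).re : ℝ) : ℂ) := by
      intro t
      obtain ⟨him, -⟩ := (mem_complexRay_iff _).1 t.2
      exact Complex.ext (by simp) (by simp [him])
    have hP_norm : ∀ t : complexRay, ‖((t : complexIntegralMonoid) : ℂ)‖ = ((t : complexIntegralMonoid) : ℂ).re := by
      intro t
      obtain ⟨-, hre⟩ := (mem_complexRay_iff _).1 t.2
      rw [hP_eq t, Complex.norm_of_nonneg hre.le, Complex.ofReal_re]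
    have rad_mem : ∀ z : complexIntegralMonoid,
        (⟨(((‖(z : ℂ)‖ : ℝ) : ℂ)), norm_mem_complexIntegralMonoid z⟩ : complexIntegralMonoid) ∈ complexRay := fun z =>
      (mem_complexRay_iff _).2 ⟨Complex.ofReal_im _, by rw [Complex.ofReal_re]; exact complexIntegralMonoid.norm_pos z⟩
    let rad : complexIntegralMonoid → complexRay := fun z => ⟨⟨_, norm_mem_complexIntegralMonoid z⟩, rad_mem z⟩
    let ang : complexIntegralMonoid → (↥complexIntegralMonoid)ˣ := fun z =>
      ⟨⟨(z : ℂ) / ((‖(z : ℂ)‖ : ℝ) : ℂ), div_norm_mem_complexIntegralMonoid z⟩,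
        ⟨((‖(z : ℂ)‖ : ℝ) : ℂ) / (z : ℂ), norm_div_mem_complexIntegralMonoid z⟩,
        Subtype.ext (by
          show (z : ℂ) / ((‖(z : ℂ)‖ : ℝ) : ℂ) * (((‖(z : ℂ)‖ : ℝ) : ℂ) / (z : ℂ)) = 1
          rw [div_mul_div_comm, mul_comm (z : ℂ),
            div_self (mul_ne_zero (complexIntegralMonoid.ofReal_norm_ne_zero z) (complexIntegralMonoid.coe_ne_zero z))]),
        Subtype.ext (by
          show ((‖(z : ℂ)‖ : ℝ) : ℂ) / (z : ℂ) * ((z : ℂ) / ((‖(z : ℂ)‖ : ℝ) : ℂ)) = 1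
          rw [div_mul_div_comm, mul_comm ((‖(z : ℂ)‖ : ℝ) : ℂ),
            div_self (mul_ne_zero (complexIntegralMonoid.coe_ne_zero z) (complexIntegralMonoid.ofReal_norm_ne_zero z))])⟩
    have hnormC : Continuous fun z : complexIntegralMonoid => ((‖(z : ℂ)‖ : ℝ) : ℂ) :=
      Complex.continuous_ofReal.comp (continuous_norm.comp continuous_subtype_val)
    have hrad : Continuous rad := Continuous.subtype_mk (Continuous.subtype_mk hnormC _) _
    have hang : Continuous ang := by
      refine Units.continuous_iff.2 ⟨?_, ?_⟩
      · exact Continuous.subtype_mk (continuous_subtype_val.div hnormC complexIntegralMonoid.ofReal_norm_ne_zero) _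
      · exact Continuous.subtype_mk (hnormC.div continuous_subtype_val complexIntegralMonoid.coe_ne_zero) _
    refine isHomeomorph_iff_exists_inverse.2 ⟨?_, fun z => (ang z, rad z), ?_, ?_, hang.prodMk hrad⟩
    · exact (Units.continuous_val.comp continuous_fst).mul (continuous_subtype_val.comp continuous_snd)
    · rintro ⟨u, t⟩
      have hu : ‖((u : complexIntegralMonoid) : ℂ)‖ = 1 := complexIntegralMonoid.norm_coe_units u
      have hnorm : ‖(((u : complexIntegralMonoid) * (t : complexIntegralMonoid) : complexIntegralMonoid) : ℂ)‖ =
          ((t : complexIntegralMonoid) : ℂ).re := by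
        rw [Submonoid.coe_mul, norm_mul, hu, one_mul, hP_norm t]
      have hre : (((t : complexIntegralMonoid) : ℂ).re : ℂ) ≠ 0 :=
        Complex.ofReal_ne_zero.2 ((mem_complexRay_iff _).1 t.2).2.ne'
      refine Prod.ext ?_ ?_
      · refine Units.ext (Subtype.ext ?_)
        show (((u : complexIntegralMonoid) * (t : complexIntegralMonoid) : complexIntegralMonoid) : ℂ) /
            ((‖(((u : complexIntegralMonoid) * (t : complexIntegralMonoid) : complexIntegralMonoid) : ℂ)‖ : ℝ) : ℂ) =
            ((u : complexIntegralMonoid) : ℂ)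
        rw [hnorm, Submonoid.coe_mul, ← hP_eq t, mul_div_assoc, div_self (by rw [hP_eq t]; exact hre), mul_one]
      · refine Subtype.ext (Subtype.ext ?_)
        show (((‖(((u : complexIntegralMonoid) * (t : complexIntegralMonoid) : complexIntegralMonoid) : ℂ)‖ : ℝ) : ℂ)) =
            ((t : complexIntegralMonoid) : ℂ)
        rw [hnorm, ← hP_eq t]
    · intro z
      refine Subtype.ext ?_
      show (z : ℂ) / ((‖(z : ℂ)‖ : ℝ) : ℂ) * ((‖(z : ℂ)‖ : ℝ) : ℂ) = (z : ℂ)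
      exact div_mul_cancel₀ _ (complexIntegralMonoid.ofReal_norm_ne_zero z)

end TMMono

/-! ## §1. The CAF chart `𝒜_𝕏 ≅ ℂ`, the integral monoid `𝒪^▷_{𝒜_𝕏}`, and the transition automorphisms `∈ {id, conj}` -/

namespace AutHolFieldFunctor

variable (𝔄 : AutHolFieldFunctor.{u})
/-- THE bicontinuous field isomorphism `e_𝕏 : 𝒜_𝕏 ≅ ℂ` (Cor 2.7 (e): "`𝒜_p` … isomorphic to `ℂ`"; `𝒜_𝕏` is a CAF), chosen once.
[cite: MochizukiAbsTopIII2015, Cor 2.7 (e) p.60] -/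
def cafChart (X : 𝔄.EA) : 𝔄.A X ≃+* ℂ := Classical.choose (𝔄.isCAF X).exists_equiv
/-- The chart is continuous. [cite: MochizukiAbsTopIII2015, Cor 2.7 (e) p.60] -/
theorem continuous_cafChart (X : 𝔄.EA) : Continuous (𝔄.cafChart X) := (Classical.choose_spec (𝔄.isCAF X).exists_equiv).1
/-- The inverse chart is continuous. [cite: MochizukiAbsTopIII2015, Cor 2.7 (e) p.60] -/
theorem continuous_cafChart_symm (X : 𝔄.EA) : Continuous (𝔄.cafChart X).symm :=
  (Classical.choose_spec (𝔄.isCAF X).exists_equiv).2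
/-- **`𝒪^▷_{𝒜_𝕏}`**: the nonzero integral elements of the CAF `𝒜_𝕏`, `e_𝕏⁻¹(𝒪^▷_ℂ) = {0 < |a| ≤ 1}` (independent of the chart: the
other chart is `conj ∘ e_𝕏`). [cite: MochizukiAbsTopIII2015, Def 5.6 (ii) p.135] -/
def integralMonoid (X : 𝔄.EA) : Submonoid (𝔄.A X) := complexIntegralMonoid.comap (𝔄.cafChart X).toRingHom.toMonoidHom
/-- Membership: `a ∈ 𝒪^▷_{𝒜_𝕏} ↔ e_𝕏(a) ∈ 𝒪^▷_ℂ`. [cite: MochizukiAbsTopIII2015, Def 5.6 (ii) p.135] -/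
theorem mem_integralMonoid_iff (X : 𝔄.EA) (a : 𝔄.A X) : a ∈ 𝔄.integralMonoid X ↔ 𝔄.cafChart X a ∈ complexIntegralMonoid :=
  Iff.rfl
/-- The chart restricted to the integral monoids: `𝒪^▷_{𝒜_𝕏} ≅ 𝒪^▷_ℂ`. [cite: MochizukiAbsTopIII2015, Def 5.6 (ii) p.135] -/
def integralChart (X : 𝔄.EA) : ↥(𝔄.integralMonoid X) ≃* ↥complexIntegralMonoid where
  toFun a := ⟨𝔄.cafChart X a, a.2⟩
  invFun z := ⟨(𝔄.cafChart X).symm z, show 𝔄.cafChart X ((𝔄.cafChart X).symm z) ∈ complexIntegralMonoid by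
    rw [RingEquiv.apply_symm_apply]; exact z.2⟩
  left_inv a := Subtype.ext ((𝔄.cafChart X).symm_apply_apply _)
  right_inv z := Subtype.ext ((𝔄.cafChart X).apply_symm_apply _)
  map_mul' a b := Subtype.ext (map_mul (𝔄.cafChart X) _ _)
/-- `integralChart` is continuous. [cite: MochizukiAbsTopIII2015, Def 5.6 (ii) p.135] -/
theorem continuous_integralChart (X : 𝔄.EA) : Continuous (𝔄.integralChart X) :=
  ((𝔄.continuous_cafChart X).comp continuous_subtype_val).subtype_mk _
/-- … and so is its inverse. [cite: MochizukiAbsTopIII2015, Def 5.6 (ii) p.135] -/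
theorem continuous_integralChart_symm (X : 𝔄.EA) : Continuous (𝔄.integralChart X).symm :=
  ((𝔄.continuous_cafChart_symm X).comp continuous_subtype_val).subtype_mk _

variable {𝔄}
/-- The transition automorphism `e_𝕐 ∘ 𝒜_f ∘ e_𝕏⁻¹` of `ℂ` attached to a morphism `f : 𝕏 → 𝕐` of `EA`.
[cite: MochizukiAbsTopIII2015, Cor 2.7 (e) p.60] -/
def transition {X Y : 𝔄.EA} (f : X ⟶ Y) : ℂ ≃+* ℂ := (𝔄.cafChart X).symm.trans ((𝔄.Amap f).trans (𝔄.cafChart Y))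
/-- `transition f (e_𝕏 a) = e_𝕐 (𝒜_f a)`. [cite: MochizukiAbsTopIII2015, Cor 2.7 (e) p.60] -/
theorem transition_apply_cafChart {X Y : 𝔄.EA} (f : X ⟶ Y) (a : 𝔄.A X) :
    transition f (𝔄.cafChart X a) = 𝔄.cafChart Y (𝔄.Amap f a) := by
  change 𝔄.cafChart Y (𝔄.Amap f ((𝔄.cafChart X).symm (𝔄.cafChart X a))) = _
  rw [RingEquiv.symm_apply_apply]
/-- **"Forgetting the rigidification"**: the transition automorphism is CONTINUOUS, hence the identity or complex
conjugation. [cite: MochizukiAbsTopIII2015, Rmk 5.8.1 (i) p.142] -/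
theorem transition_eq_id_or_conj {X Y : 𝔄.EA} (f : X ⟶ Y) :
    (transition f).toRingHom = RingHom.id ℂ ∨ (transition f).toRingHom = starRingEnd ℂ :=
  Complex.ringHom_eq_id_or_conj_of_continuous
    ((𝔄.continuous_cafChart Y).comp ((𝔄.continuous_Amap f).comp (𝔄.continuous_cafChart_symm X)))
/-- Consequently `e_𝕐(𝒜_f a)` is `e_𝕏(a)` or its conjugate. [cite: MochizukiAbsTopIII2015, Rmk 5.8.1 (i) p.142] -/
theorem cafChart_Amap_eq_or {X Y : 𝔄.EA} (f : X ⟶ Y) (a : 𝔄.A X) :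
    𝔄.cafChart Y (𝔄.Amap f a) = 𝔄.cafChart X a ∨ 𝔄.cafChart Y (𝔄.Amap f a) = starRingEnd ℂ (𝔄.cafChart X a) := by
  rw [← transition_apply_cafChart]
  rcases transition_eq_id_or_conj f with h | h
  · left; exact (RingHom.congr_fun h (𝔄.cafChart X a) : _)
  · right; exact (RingHom.congr_fun h (𝔄.cafChart X a) : _)
/-- `𝒜_f` preserves the absolute value read in the charts. [cite: MochizukiAbsTopIII2015, Rmk 5.8.1 (i) p.142] -/
theorem norm_cafChart_Amap {X Y : 𝔄.EA} (f : X ⟶ Y) (a : 𝔄.A X) : ‖𝔄.cafChart Y (𝔄.Amap f a)‖ = ‖𝔄.cafChart X a‖ := by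
  rcases cafChart_Amap_eq_or f a with h | h
  · rw [h]
  · rw [h, Complex.norm_conj]
/-- `𝒜_f` preserves the real part read in the charts. [cite: MochizukiAbsTopIII2015, Rmk 5.8.1 (i) p.142] -/
theorem re_cafChart_Amap {X Y : 𝔄.EA} (f : X ⟶ Y) (a : 𝔄.A X) : (𝔄.cafChart Y (𝔄.Amap f a)).re = (𝔄.cafChart X a).re := by
  rcases cafChart_Amap_eq_or f a with h | h
  · rw [h]
  · rw [h, Complex.conj_re]
/-- `𝒜_f` preserves "the imaginary part vanishes" read in the charts. [cite: MochizukiAbsTopIII2015, Rmk 5.8.1 (i) p.142] -/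
theorem im_cafChart_Amap_eq_zero_iff {X Y : 𝔄.EA} (f : X ⟶ Y) (a : 𝔄.A X) :
    (𝔄.cafChart Y (𝔄.Amap f a)).im = 0 ↔ (𝔄.cafChart X a).im = 0 := by
  rcases cafChart_Amap_eq_or f a with h | h
  · rw [h]
  · rw [h, Complex.conj_im, neg_eq_zero]
/-- `𝒜_f` carries `𝒪^▷_{𝒜_𝕏}` into `𝒪^▷_{𝒜_𝕐}`. [cite: MochizukiAbsTopIII2015, Def 5.6 (ii) p.135] -/
theorem Amap_mem_integralMonoid {X Y : 𝔄.EA} (f : X ⟶ Y) {a : 𝔄.A X} (ha : a ∈ 𝔄.integralMonoid X) :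
    𝔄.Amap f a ∈ 𝔄.integralMonoid Y := by
  rw [mem_integralMonoid_iff, mem_complexIntegralMonoid_iff, norm_cafChart_Amap] at *
  exact ha
/-- `𝒜_f⁻¹` carries `𝒪^▷_{𝒜_𝕐}` into `𝒪^▷_{𝒜_𝕏}`. [cite: MochizukiAbsTopIII2015, Def 5.6 (ii) p.135] -/
theorem Amap_symm_mem_integralMonoid {X Y : 𝔄.EA} (f : X ⟶ Y) {b : 𝔄.A Y} (hb : b ∈ 𝔄.integralMonoid Y) :
    (𝔄.Amap f).symm b ∈ 𝔄.integralMonoid X := by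
  have h := norm_cafChart_Amap f ((𝔄.Amap f).symm b)
  rw [RingEquiv.apply_symm_apply] at h
  rw [mem_integralMonoid_iff, mem_complexIntegralMonoid_iff, ← h]
  exact (mem_complexIntegralMonoid_iff).1 hb
/-- **`𝒜_f|_{𝒪^▷}` : `𝒪^▷_{𝒜_𝕏} ≅ 𝒪^▷_{𝒜_𝕐}`** as an isomorphism of monoids. [cite: MochizukiAbsTopIII2015, Def 5.6 (ii) p.135] -/
def integralMap {X Y : 𝔄.EA} (f : X ⟶ Y) : ↥(𝔄.integralMonoid X) ≃* ↥(𝔄.integralMonoid Y) where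
  toFun a := ⟨𝔄.Amap f a, Amap_mem_integralMonoid f a.2⟩
  invFun b := ⟨(𝔄.Amap f).symm b, Amap_symm_mem_integralMonoid f b.2⟩
  left_inv a := Subtype.ext ((𝔄.Amap f).symm_apply_apply a.1)
  right_inv b := Subtype.ext ((𝔄.Amap f).apply_symm_apply b.1)
  map_mul' a b := Subtype.ext (map_mul (𝔄.Amap f) a.1 b.1)
/-- `integralMap` on elements. [cite: MochizukiAbsTopIII2015, Def 5.6 (ii) p.135] -/
@[simp] theorem integralMap_apply_coe {X Y : 𝔄.EA} (f : X ⟶ Y) (a : ↥(𝔄.integralMonoid X)) :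
    ((integralMap f a : ↥(𝔄.integralMonoid Y)) : 𝔄.A Y) = 𝔄.Amap f a := rfl
/-- `𝒜_f` preserves the ray `e⁻¹(]0,1])` read in the charts (`Re`, `Im = 0` are preserved).
[cite: MochizukiAbsTopIII2015, Def 5.6 (ii) p.135] -/
theorem integralChart_integralMap_mem_complexRay_iff {X Y : 𝔄.EA} (f : X ⟶ Y) (a : ↥(𝔄.integralMonoid X)) :
    𝔄.integralChart Y (integralMap f a) ∈ TMMono.complexRay ↔ 𝔄.integralChart X a ∈ TMMono.complexRay := by
  rw [TMMono.mem_complexRay_iff, TMMono.mem_complexRay_iff]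
  change (𝔄.cafChart Y (𝔄.Amap f a)).im = 0 ∧ 0 < (𝔄.cafChart Y (𝔄.Amap f a)).re ↔
    (𝔄.cafChart X a).im = 0 ∧ 0 < (𝔄.cafChart X a).re
  rw [im_cafChart_Amap_eq_zero_iff, re_cafChart_Amap]

/-! ## §2. The mono-analyticization functor `EA → TM⊢`, `𝕏 ↦ G_𝕏 = (𝒪^▷_{𝒜_𝕏}, 𝒪^▷_{𝒜_𝕏} ∩ ℝ_{>0})` -/

variable (𝔄)
/-- **`G_𝕏 := (𝒪^▷_{𝒜_𝕏}, 𝒪^▷_{𝒜_𝕏} ∩ ℝ_{>0}) ∈ Ob(TM⊢)`** (Def 5.6 (ii)(c)): the standard object transported along the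
chart `𝒪^▷_{𝒜_𝕏} ≅ 𝒪^▷_ℂ` (ray `= e_𝕏⁻¹(]0,1])`), lifted one universe for the §5 interface.
[cite: MochizukiAbsTopIII2015, Def 5.6 (ii) p.135] -/
def toTMMonoObj (X : 𝔄.EA) : TMMono.{u + 1} :=
  TMMono.ulift.{u + 1, u}
    (TMMono.complexModel.ofMulEquiv (↥(𝔄.integralMonoid X)) (𝔄.integralChart X) (𝔄.continuous_integralChart X)
      (𝔄.continuous_integralChart_symm X))
/-- The carrier of `G_𝕏` is (the lift of) `𝒪^▷_{𝒜_𝕏}`. [cite: MochizukiAbsTopIII2015, Def 5.6 (ii) p.135] -/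
theorem toTMMonoObj_C (X : 𝔄.EA) : (𝔄.toTMMonoObj X).C = ULift.{u + 1} ↥(𝔄.integralMonoid X) := rfl
/-- The ray of `G_𝕏` is `e_𝕏⁻¹(]0,1])`: membership read in the chart. [cite: MochizukiAbsTopIII2015, Def 5.6 (ii) p.135] -/
theorem mem_toTMMonoObj_pos_iff (X : 𝔄.EA) (x : (𝔄.toTMMonoObj X).C) :
    x ∈ (𝔄.toTMMonoObj X).pos ↔ 𝔄.integralChart X x.down ∈ TMMono.complexRay := Iff.rfl

variable {𝔄}
/-- **`G_f := 𝒜_f|_{𝒪^▷}` as a morphism of `TM⊢`**: an isomorphism of topological monoids `𝒪^▷_{𝒜_𝕏} ≅ 𝒪^▷_{𝒜_𝕐}` carrying the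
ray onto the ray (the transition automorphism is `id` or `conj`). [cite: MochizukiAbsTopIII2015, Def 5.6 (ii) p.135] -/
def toTMMonoMap {X Y : 𝔄.EA} (f : X ⟶ Y) : 𝔄.toTMMonoObj X ⟶ 𝔄.toTMMonoObj Y where
  toMulEquiv := MulEquiv.ulift.trans ((integralMap f).trans MulEquiv.ulift.symm)
  continuous_toFun := continuous_uliftUp.comp
    ((((𝔄.continuous_Amap f).comp continuous_subtype_val).subtype_mk _).comp continuous_uliftDown)
  continuous_invFun := continuous_uliftUp.comp
    ((((𝔄.continuous_Amap_symm f).comp continuous_subtype_val).subtype_mk _).comp continuous_uliftDown)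
  map_pos := by
    ext y
    constructor
    · rintro ⟨x, hx, rfl⟩
      exact (𝔄.mem_toTMMonoObj_pos_iff Y _).2
        ((integralChart_integralMap_mem_complexRay_iff f x.down).2 ((𝔄.mem_toTMMonoObj_pos_iff X x).1 hx))
    · intro hy
      refine ⟨ULift.up ((integralMap f).symm y.down), ?_, ?_⟩
      · refine (𝔄.mem_toTMMonoObj_pos_iff X _).2 ?_
        have h := (integralChart_integralMap_mem_complexRay_iff f ((integralMap f).symm y.down))
        rw [MulEquiv.apply_symm_apply] at h
        exact h.1 ((𝔄.mem_toTMMonoObj_pos_iff Y y).1 hy)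
      · change ULift.up (integralMap f ((integralMap f).symm y.down)) = y
        rw [MulEquiv.apply_symm_apply]
        rfl
/-- `G_f` on elements: `a ↦ 𝒜_f(a)`. [cite: MochizukiAbsTopIII2015, Def 5.6 (ii) p.135] -/
theorem toTMMonoMap_apply {X Y : 𝔄.EA} (f : X ⟶ Y) (x : (𝔄.toTMMonoObj X).C) :
    (toTMMonoMap f).toMulEquiv x = ULift.up (integralMap f x.down) := rfl

variable (𝔄)
/-- **The mono-analyticization functor `EA → TM⊢`** (Def 5.6 (ii)(c) / Def 5.9 (i)): `𝕏 ↦ G_𝕏 = (𝒪^▷_{𝒜_𝕏}, 𝒪^▷_{𝒜_𝕏} ∩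
ℝ_{>0})`, `f ↦ 𝒜_f|_{𝒪^▷}`; the functor laws are Cor 2.7's functoriality `𝒜_{id} = id`, `𝒜_{g ∘ f} = 𝒜_g ∘ 𝒜_f`.
[cite: MochizukiAbsTopIII2015, Def 5.6 (ii) p.135] -/
def toTMMono : 𝔄.EA ⥤ TMMono.{u + 1} where
  obj X := 𝔄.toTMMonoObj X
  map f := toTMMonoMap f
  map_id X := by
    refine TMMono.Iso.ext (MulEquiv.ext fun x => ?_)
    change ULift.up (integralMap (𝟙 X) x.down) = x
    refine congrArg ULift.up (Subtype.ext ?_)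
    change 𝔄.Amap (𝟙 X) (x.down : ↥(𝔄.integralMonoid X)).1 = (x.down : ↥(𝔄.integralMonoid X)).1
    rw [𝔄.Amap_id_apply]
  map_comp f g := by
    refine TMMono.Iso.ext (MulEquiv.ext fun x => ?_)
    change ULift.up (integralMap (f ≫ g) x.down) = ULift.up (integralMap g (integralMap f x.down))
    refine congrArg ULift.up (Subtype.ext ?_)
    change 𝔄.Amap (f ≫ g) (x.down : ↥(𝔄.integralMonoid _)).1 = 𝔄.Amap g (𝔄.Amap f (x.down : ↥(𝔄.integralMonoid _)).1)
    rw [𝔄.Amap_comp_apply]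
/-- **Rmk 5.8.1 (i) made visible**: every endomorphism of `𝕏` in `EA` acts on `G_𝕏` through a transition automorphism
`∈ {id, conj}` of the chart — the Aut-holomorphic rigidification is forgotten. [cite: MochizukiAbsTopIII2015, Rmk 5.8.1 (i) p.142] -/
theorem toTMMono_map_chart_eq_or {X : 𝔄.EA} (f : X ⟶ X) (x : (𝔄.toTMMonoObj X).C) :
    (𝔄.integralChart X ((𝔄.toTMMono.map f).toMulEquiv x).down : ℂ) = 𝔄.integralChart X x.down ∨
      (𝔄.integralChart X ((𝔄.toTMMono.map f).toMulEquiv x).down : ℂ) = starRingEnd ℂ (𝔄.integralChart X x.down) :=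
  cafChart_Amap_eq_or f (x.down : ↥(𝔄.integralMonoid X)).1

end AutHolFieldFunctor

/-! ## §3. The §5 setting with the GENUINE arrow `ℰ• → ℰ⊢` -/

namespace LogFrobeniusSetting

variable (𝔄 : AutHolFieldFunctor.{u})
/-- **`archGenuineMonoAn 𝔄` with the mono-analyticization `ℰ• = EA → ℰ⊢ = TM⊢` GENUINE** (`toTMMono`), and
`𝒩_v → 𝒩⊢_v := (𝕏 ↶ M) ↦ (G_𝕏, k∼)` genuine in the `TM⊢`-component ((L1′): the `TB⊞`-component is the constant `k∼`).
[cite: MochizukiAbsTopIII2015, Def 5.6 (ii) p.135] -/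
def archGenuineMonoAnChart (Vmod : Type (u + 1)) (isArc : Vmod → Bool) : LogFrobeniusSetting Vmod isArc :=
  { archGenuineMonoAn 𝔄 Vmod isArc with
    monoAn := inducedFunctor _ ⋙ 𝔄.toTMMono
    monoNplus := fun _ => (inducedFunctor _ ⋙ HolTHPair.toEA 𝔄 ⋙ 𝔄.toTMMono).prod'
      ((Functor.const _).obj TMMono.kTildeObj.{u + 1})
    monoN := fun _ => (inducedFunctor _ ⋙ HolTHPair.toEA 𝔄 ⋙ 𝔄.toTMMono).prod'
      ((Functor.const _).obj TMMono.kTildeObj.{u + 1})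
    monoHomotopy := fun _ => Iso.refl _ }

variable (Vmod : Type (u + 1)) (isArc : Vmod → Bool)
/-- The mono-analyticization arrow of the setting IS `toTMMono` (after the universe bookkeeping `Up EA → EA`).
[cite: MochizukiAbsTopIII2015, Def 5.6 (ii) p.135] -/
theorem archGenuineMonoAnChart_monoAn :
    (archGenuineMonoAnChart 𝔄 Vmod isArc).monoAn = inducedFunctor _ ⋙ 𝔄.toTMMono := rfl
/-- The Prop 5.8 (vii) rows are those of `archGenuineMonoAn` (genuine `ψArc`). [cite: MochizukiAbsTopIII2015, Prop 5.8 (vii) p.141] -/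
theorem archGenuineMonoAnChart_ψAnMono (w : Vmod) (ν : {ν : LogVertex (isArc w) // ν.IsCross}) :
    (archGenuineMonoAnChart 𝔄 Vmod isArc).ψAnMono w ν = TMMono.ψArc (isArc w) ν.1 := rfl
/-- `ψ^{An⊢⊞}_{w,ν}` lies over `ℰ⊢` ON THE NOSE. [cite: MochizukiAbsTopIII2015, Definition 5.6 (iv) p.136] -/
theorem archGenuineMonoAnChart_ψOver (w : Vmod) (ν : {ν : LogVertex (isArc w) // ν.IsCross}) :
    (archGenuineMonoAnChart 𝔄 Vmod isArc).ψAnMono w ν ⋙ (archGenuineMonoAnChart 𝔄 Vmod isArc).forgetMono w ⋙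
        (archGenuineMonoAnChart 𝔄 Vmod isArc).toEmono w =
      (archGenuineMonoAnChart 𝔄 Vmod isArc).κAnMono.inverse := rfl
/-- rows 4 → 5 ON THE NOSE with the GENUINE arrows: `(𝕏 ↶ M) ↦ G_𝕏` both ways round the square.
[cite: MochizukiAbsTopIII2015, Cor 5.10 p. 146] -/
theorem archGenuineMonoAnChart_monoN_toEmono_eq (v : Vmod) :
    (archGenuineMonoAnChart 𝔄 Vmod isArc).monoN v ⋙ (archGenuineMonoAnChart 𝔄 Vmod isArc).toEmono v =
      (archGenuineMonoAnChart 𝔄 Vmod isArc).toE v ⋙ (archGenuineMonoAnChart 𝔄 Vmod isArc).monoAn := rfl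
/-- rows 6 → 7 ON THE NOSE. [cite: MochizukiAbsTopIII2015, Cor 5.10 p. 146] -/
theorem archGenuineMonoAnChart_κAn₂_monoAn_eq :
    (archGenuineMonoAnChart 𝔄 Vmod isArc).κAn₂.functor ⋙ (archGenuineMonoAnChart 𝔄 Vmod isArc).monoAn =
      (archGenuineMonoAnChart 𝔄 Vmod isArc).κAn.inverse ⋙ (archGenuineMonoAnChart 𝔄 Vmod isArc).monoAn := rfl
/-- abc-iut-L4-t3's `MonoAnalyticizationHomotopies` is INHABITED at the setting. [cite: MochizukiAbsTopIII2015, Cor 5.10 p. 146] -/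
def archGenuineMonoAnChart_monoAnalyticizationHomotopies :
    (archGenuineMonoAnChart 𝔄 Vmod isArc).MonoAnalyticizationHomotopies where
  toE v := eqToIso (archGenuineMonoAnChart_monoN_toEmono_eq 𝔄 Vmod isArc v)
  anToE := Functor.isoWhiskerLeft
    ((archGenuineMonoAnChart 𝔄 Vmod isArc).κAn.inverse ⋙ (archGenuineMonoAnChart 𝔄 Vmod isArc).monoAn)
    (archGenuineMonoAnChart 𝔄 Vmod isArc).κAnMono.unitIso.symm
/-- **[AbsTopIII] Cor 5.10 (iv)(a) HOLDS at the setting** for `V(F_mod) ≠ ∅`. [cite: MochizukiAbsTopIII2015, Cor 5.10 (iv)(a) p.147] -/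
theorem archGenuineMonoAnChart_cor510MonoCores [Nonempty Vmod] : (archGenuineMonoAnChart 𝔄 Vmod isArc).Cor510MonoCores :=
  cor510MonoCores_holds (archGenuineMonoAnChart_monoAnalyticizationHomotopies 𝔄 Vmod isArc)
/-- **Cor 5.5 (iv), sentence 1 (`⊞`-half) HOLDS here** (holomorphic rows = abc-iut-w4-d095's genuine ones).
[cite: MochizukiAbsTopIII2015, Cor 5.5 (iv) p. 131] -/
theorem archGenuineMonoAnChart_cor55Incompatibility (v₀ : Vmod) (hv₀ : isArc v₀ = true) (x₀ : Up (HolTFPair 𝔄)) :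
    (archGenuineMonoAnChart 𝔄 Vmod isArc).Cor55Incompatibility :=
  (archGenuineMonoAnChart 𝔄 Vmod isArc).cor55Incompatibility_of_iota_spaceLink_not_surjective v₀ hv₀ x₀
    (inducedFunctor _ ⋙ HolTHPair.forget 𝔄)
    (fun ν _ ε => forget_archIota_spaceLink_not_surjective 𝔄 (isArc v₀) hv₀ ν ε x₀)
/-- **Summary**: a §5 setting over the Aut-holomorphic model with `ℰ⊢ = TM⊢`, the GENUINE mono-analyticization `EA → TM⊢`,
print's `An⊢[𝒩⊢⊞_w]` with `ψ` over `ℰ⊢` on the nose, Cor 5.10 (iv)(a) for `V(F_mod) ≠ ∅` and Cor 5.5 (iv) s1 at every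
archimedean place. [cite: MochizukiAbsTopIII2015, Def 5.6 (ii) p.135] -/
theorem exists_archGenuineMonoAnChart :
    ∃ L : LogFrobeniusSetting Vmod isArc,
      L.X = Up (HolTFPair 𝔄) ∧ L.E = Up 𝔄.EA ∧ L.Emono = TMMono.{u + 1} ∧ L.AnMono = TMMono.AnArc.{u + 1} ∧ (∀ w ν, L.ψAnMono w ν ⋙ L.forgetMono w ⋙ L.toEmono w = L.κAnMono.inverse) ∧
      (Nonempty Vmod → L.Cor510MonoCores) ∧ (∀ v₀, isArc v₀ = true → Nonempty (Up (HolTFPair 𝔄)) → L.Cor55Incompatibility) :=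
  ⟨archGenuineMonoAnChart 𝔄 Vmod isArc, rfl, rfl, rfl, rfl, archGenuineMonoAnChart_ψOver 𝔄 Vmod isArc,
    fun h => haveI := h; archGenuineMonoAnChart_cor510MonoCores 𝔄 Vmod isArc,
    fun v₀ hv₀ ⟨x₀⟩ => archGenuineMonoAnChart_cor55Incompatibility 𝔄 Vmod isArc v₀ hv₀ x₀⟩

end LogFrobeniusSetting

end Literature.AnabelianGeometry.AbsoluteAnabelian

end
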